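import Mathlib
import HarnessLib

/-!
# A finite measure whose small balls compare two-sidedly with those at the origin is locally dominated by Lebesgue measure

HONEST FRAMING: exact (Metropolis-corrected) sampling algorithms for lattice gauge theory;
figures of merit are autocorrelation/cost numbers at stated couplings and volumes; no
continuum-physics claim.

Venture `LatticeQCDFlow` (cell pub-lqcd), topic `Exactness`, FANOUT row 9 (eng-latcore, the
engine `latflow.core`: its `SU(N)` Metropolis and HMC updates move links by `exp` of a random
algebra element).  NEW WORK of the cell over Mathlib (additive Haar measure on a finite-dimensional
real normed space: `Measure.addHaar_closedBall`, `addHaar_closedBall_center`; Tonelli for the product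
measure, `Measure.prod_apply` / `prod_apply_symm`; the Besicovitch–Vitali differentiation machinery
`Besicovitch.vitaliFamily`, `VitaliFamily.measure_le_of_frequently_le`); nothing here is cited as a
fact.  Printed counterpart, NAMED ONLY: Mattila, *Geometry of Sets and Measures in Euclidean Spaces*
(1995) §2 (comparison of measures through balls).

THE POINT (group-free half of the `SU(N)` exponential-chart minorisation).  Read the Haar
probability of `SU(N)` near `1` through the logarithm as a finite measure `λ` on the Lie algebra
`E ≅ ℝ^d`.  Left invariance of Haar measure and a Lipschitz estimate for the chart-transported
multiplication give exactly two inequalities: a small ball at the origin is lighter than the `L`-fold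
ball at any nearby centre, and conversely (`h₁`, `h₂` below).  This file shows, with no group in
sight, that such a `λ` is dominated near the origin by a CONSTANT MULTIPLE OF LEBESGUE MEASURE:
* §1 `lintegral_measure_closedBall_eq` — Tonelli: `∫ λ(B̄(x,s)) dμ(x) = μ(B̄(0,s)) · λ(E)` for an
  additive Haar measure `μ`;
  **`measure_closedBall_origin_le`** — GROWTH: from `h₁`, `λ(B̄(0,ρ)) · μ(B(0,r)) ≤ μ(B̄(0,Lρ)) · λ(E)`,
  so `λ(B̄(0,ρ)) ≤ C ρ^d` (averaging `h₁` over the centre against `μ`);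
* §2 **`measure_closedBall_le_smul`** — with `h₂`: `λ(B̄(x,ρ)) ≤ C · μ(B̄(x,ρ))` for every centre in
  the core ball and every small radius (`μ(B̄(x,ρ)) = ρ^d μ(B(0,1))`);
* §3 `measure_le_smul_of_closedBall`, **`restrict_le_smul_of_closedBall_comparison`** — hence `λ|_{B(0,r)} ≤ C • μ|_{B(0,r)}` with a
  constant `0 < C < ∞` (Besicovitch covering: a measure is below `C μ` on a set at each point of which
  small closed balls satisfy the inequality).

NOT CLAIMED: any value of the constant beyond the displayed product; absolute continuity statements
away from the core ball; the converse domination.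
-/

noncomputable section

namespace Summit.Ventures.LatticeQCDFlow.Exactness

open MeasureTheory Measure Set Metric Filter Topology
open scoped ENNReal NNReal

variable {E : Type*} [NormedAddCommGroup E] [NormedSpace ℝ E] [FiniteDimensional ℝ E]
  [MeasurableSpace E] [BorelSpace E] (μ : Measure E) [IsAddHaarMeasure μ] (lam : Measure E) [IsFiniteMeasure lam]

/-! ## §1 Tonelli and the growth bound at the origin -/

/-- The closed distance relation is a measurable subset of `E × E`. -/
theorem measurableSet_dist_le (s : ℝ) : MeasurableSet {p : E × E | dist p.1 p.2 ≤ s} :=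
  (isClosed_le continuous_dist continuous_const).measurableSet

/-- **Tonelli for balls**: `∫ λ(B̄(x,s)) dμ(x) = μ(B̄(0,s)) · λ(E)` (both sides are the product measure
of `{dist ≤ s}`; `μ` is translation invariant). -/
theorem lintegral_measure_closedBall_eq (s : ℝ) :
    ∫⁻ x, lam (closedBall x s) ∂μ = μ (closedBall 0 s) * lam univ := by
  have hS := measurableSet_dist_le (E := E) s
  have h1 : ∀ x : E, closedBall x s = Prod.mk x ⁻¹' {p : E × E | dist p.1 p.2 ≤ s} := fun x => by
    ext y; simp [mem_closedBall, dist_comm]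
  have h2 : ∀ y : E, (fun x : E => (x, y)) ⁻¹' {p : E × E | dist p.1 p.2 ≤ s} = closedBall y s := fun y => by
    ext x; simp [mem_closedBall]
  calc ∫⁻ x, lam (closedBall x s) ∂μ = ∫⁻ x, lam (Prod.mk x ⁻¹' {p : E × E | dist p.1 p.2 ≤ s}) ∂μ := by
        simp_rw [h1]
    _ = (μ.prod lam) {p : E × E | dist p.1 p.2 ≤ s} := (Measure.prod_apply hS).symm
    _ = ∫⁻ y, μ ((fun x : E => (x, y)) ⁻¹' {p : E × E | dist p.1 p.2 ≤ s}) ∂lam := Measure.prod_apply_symm hS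
    _ = ∫⁻ y, μ (closedBall 0 s) ∂lam := by simp_rw [h2, addHaar_closedBall_center]
    _ = μ (closedBall 0 s) * lam univ := by rw [lintegral_const]

variable {μ lam}

/-- **GROWTH AT THE ORIGIN.**  If every ball `B̄(0,ρ)`, `0 < ρ ≤ ρ₀`, is lighter than the ball
`B̄(x,Lρ)` at every centre `x` of the core ball `B(0,r)`, then
`λ(B̄(0,ρ)) · μ(B(0,r)) ≤ μ(B̄(0,Lρ)) · λ(E)`. -/
theorem measure_closedBall_origin_le {r ρ₀ L : ℝ}
    (h₁ : ∀ x ∈ ball (0 : E) r, ∀ ρ : ℝ, 0 < ρ → ρ ≤ ρ₀ → lam (closedBall 0 ρ) ≤ lam (closedBall x (L * ρ)))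
    {ρ : ℝ} (hρ : 0 < ρ) (hρ₀ : ρ ≤ ρ₀) :
    lam (closedBall 0 ρ) * μ (ball 0 r) ≤ μ (closedBall 0 (L * ρ)) * lam univ := by
  calc lam (closedBall 0 ρ) * μ (ball 0 r) = ∫⁻ _ in ball (0 : E) r, lam (closedBall 0 ρ) ∂μ := by
        rw [setLIntegral_const]
    _ ≤ ∫⁻ x in ball (0 : E) r, lam (closedBall x (L * ρ)) ∂μ :=
        setLIntegral_mono' measurableSet_ball fun x hx => h₁ x hx ρ hρ hρ₀
    _ ≤ ∫⁻ x, lam (closedBall x (L * ρ)) ∂μ := setLIntegral_le_lintegral _ _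
    _ = μ (closedBall 0 (L * ρ)) * lam univ := lintegral_measure_closedBall_eq μ lam _

/-! ## §2 Small balls at every centre of the core are below a constant times Lebesgue -/

omit [FiniteDimensional ℝ E] [BorelSpace E] in
/-- The comparison constant `L^{2d} · λ(E) / μ(B(0,r))` is finite (for `r > 0`). -/
theorem ballComparisonConst_ne_top {r : ℝ} (hr : 0 < r) (L : ℝ) :
    ENNReal.ofReal (L ^ (2 * Module.finrank ℝ E)) * lam univ * (μ (ball 0 r))⁻¹ ≠ ⊤ := by
  refine ENNReal.mul_ne_top (ENNReal.mul_ne_top ENNReal.ofReal_ne_top (measure_ne_top _ _)) ?_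
  exact ENNReal.inv_ne_top.2 (measure_ball_pos μ 0 hr).ne'

/-- **THE BALL INEQUALITY.**  Under both comparisons (`h₁`: origin ball below the `L`-fold ball at
`x`; `h₂`: ball at `x` below the `L`-fold origin ball), for every centre `x ∈ B(0,r)` and every
`0 < ρ ≤ ρ₀/L`: `λ(B̄(x,ρ)) ≤ C · μ(B̄(x,ρ))`, `C = L^{2d} λ(E)/μ(B(0,r))`. -/
theorem measure_closedBall_le_smul {r ρ₀ L : ℝ} (hr : 0 < r) (hL : 1 ≤ L)
    (h₁ : ∀ x ∈ ball (0 : E) r, ∀ ρ : ℝ, 0 < ρ → ρ ≤ ρ₀ → lam (closedBall 0 ρ) ≤ lam (closedBall x (L * ρ)))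
    (h₂ : ∀ x ∈ ball (0 : E) r, ∀ ρ : ℝ, 0 < ρ → ρ ≤ ρ₀ → lam (closedBall x ρ) ≤ lam (closedBall 0 (L * ρ)))
    {x : E} (hx : x ∈ ball (0 : E) r) {ρ : ℝ} (hρ : 0 < ρ) (hρL : L * ρ ≤ ρ₀) :
    lam (closedBall x ρ) ≤
      ENNReal.ofReal (L ^ (2 * Module.finrank ℝ E)) * lam univ * (μ (ball 0 r))⁻¹ * μ (closedBall x ρ) := by
  have hL0 : 0 < L := lt_of_lt_of_le one_pos hL
  have hρ₀ : ρ ≤ ρ₀ := le_trans (le_mul_of_one_le_left hρ.le hL) hρL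
  have hd := Module.finrank ℝ E
  have hμr : μ (ball 0 r) ≠ 0 := (measure_ball_pos μ 0 hr).ne'
  have hμr' : μ (ball 0 r) ≠ ⊤ := (measure_ball_lt_top (μ := μ) (x := (0 : E)) (r := r)).ne
  -- growth at radius `L ρ`
  have hg := measure_closedBall_origin_le (μ := μ) h₁ (mul_pos hL0 hρ) hρL
  -- `λ(B̄(x,ρ)) ≤ λ(B̄(0,Lρ)) ≤ μ(B̄(0,L·Lρ)) λ(E) / μ(B(0,r))`
  have hstep : lam (closedBall x ρ) * μ (ball 0 r) ≤ μ (closedBall 0 (L * (L * ρ))) * lam univ :=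
    le_trans (mul_le_mul_left (h₂ x hx ρ hρ hρ₀) _) hg
  -- Lebesgue scaling: `μ(B̄(0,L²ρ)) = L^{2d} μ(B̄(x,ρ))`
  have hscale : μ (closedBall 0 (L * (L * ρ))) = ENNReal.ofReal (L ^ (2 * Module.finrank ℝ E)) * μ (closedBall x ρ) := by
    have hpow : (L * (L * ρ)) ^ Module.finrank ℝ E = L ^ (2 * Module.finrank ℝ E) * ρ ^ Module.finrank ℝ E := by
      rw [show L * (L * ρ) = L ^ 2 * ρ by ring, mul_pow, ← pow_mul]
    rw [addHaar_closedBall μ _ (by positivity), addHaar_closedBall μ _ hρ.le, hpow,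
      ENNReal.ofReal_mul (by positivity), mul_assoc]
  rw [hscale] at hstep
  calc lam (closedBall x ρ) = lam (closedBall x ρ) * μ (ball 0 r) * (μ (ball 0 r))⁻¹ := by
        rw [mul_assoc, ENNReal.mul_inv_cancel hμr hμr', mul_one]
    _ ≤ ENNReal.ofReal (L ^ (2 * Module.finrank ℝ E)) * μ (closedBall x ρ) * lam univ * (μ (ball 0 r))⁻¹ := by
        gcongr
    _ = ENNReal.ofReal (L ^ (2 * Module.finrank ℝ E)) * lam univ * (μ (ball 0 r))⁻¹ * μ (closedBall x ρ) := by
        ring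

/-! ## §3 Domination of the restriction by Besicovitch–Vitali -/

/-- **A MEASURE BELOW `C μ` ON SMALL CLOSED BALLS CENTRED IN A SET IS BELOW `C μ` ON THAT SET**
(Besicovitch–Vitali differentiation: `VitaliFamily.measure_le_of_frequently_le`). -/
theorem measure_le_smul_of_closedBall {s : Set E} {C : ℝ≥0} {ρ₁ : ℝ} (hρ₁ : 0 < ρ₁)
    (h : ∀ x ∈ s, ∀ ρ : ℝ, 0 < ρ → ρ ≤ ρ₁ → lam (closedBall x ρ) ≤ (C : ℝ≥0∞) * μ (closedBall x ρ)) :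
    lam s ≤ (C : ℝ≥0∞) * μ s := by
  have hmain : lam s ≤ (C • μ) s := by
    refine (Besicovitch.vitaliFamily lam).measure_le_of_frequently_le (C • μ)
      Measure.AbsolutelyContinuous.rfl s fun x hx => ?_
    rw [VitaliFamily.frequently_filterAt_iff]
    intro ε hε
    refine ⟨closedBall x (min ε ρ₁), mem_image_of_mem _ (lt_min hε hρ₁),
      closedBall_subset_closedBall (min_le_left _ _), ?_⟩
    rw [Measure.smul_apply, ENNReal.smul_def, smul_eq_mul]
    exact h x hx _ (lt_min hε hρ₁) (min_le_right _ _)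
  rwa [Measure.smul_apply, ENNReal.smul_def, smul_eq_mul] at hmain

/-- **LOCAL DOMINATION BY LEBESGUE MEASURE.**  A finite measure `λ` on a finite-dimensional real
normed space whose closed balls satisfy, for some `L ≥ 1`, `ρ₀ > 0` and every centre `x` of the
core ball `B(0,r)` and every `0 < ρ ≤ ρ₀`, both `λ(B̄(0,ρ)) ≤ λ(B̄(x,Lρ))` and
`λ(B̄(x,ρ)) ≤ λ(B̄(0,Lρ))`, is dominated on the core ball by a constant multiple of the additive
Haar measure `μ`: `λ|_{B(0,r)} ≤ C • μ|_{B(0,r)}` with `0 < C < ∞`. -/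
theorem restrict_le_smul_of_closedBall_comparison {r ρ₀ L : ℝ} (hr : 0 < r) (hρ₀ : 0 < ρ₀) (hL : 1 ≤ L)
    (h₁ : ∀ x ∈ ball (0 : E) r, ∀ ρ : ℝ, 0 < ρ → ρ ≤ ρ₀ → lam (closedBall 0 ρ) ≤ lam (closedBall x (L * ρ)))
    (h₂ : ∀ x ∈ ball (0 : E) r, ∀ ρ : ℝ, 0 < ρ → ρ ≤ ρ₀ → lam (closedBall x ρ) ≤ lam (closedBall 0 (L * ρ))) :
    ∃ C : ℝ≥0, 0 < C ∧ lam.restrict (ball 0 r) ≤ (C : ℝ≥0∞) • μ.restrict (ball 0 r) := by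
  have hL0 : 0 < L := lt_of_lt_of_le one_pos hL
  set C : ℝ≥0 := max 1 (ENNReal.ofReal (L ^ (2 * Module.finrank ℝ E)) * lam univ * (μ (ball 0 r))⁻¹).toNNReal with hC
  have hCle : ENNReal.ofReal (L ^ (2 * Module.finrank ℝ E)) * lam univ * (μ (ball 0 r))⁻¹ ≤ (C : ℝ≥0∞) := by
    rw [hC, ENNReal.coe_max, ENNReal.coe_toNNReal (ballComparisonConst_ne_top (μ := μ) (lam := lam) hr L)]
    exact le_max_right _ _
  refine ⟨C, lt_of_lt_of_le one_pos (le_max_left _ _), Measure.le_iff.2 fun t ht => ?_⟩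
  rw [Measure.restrict_apply ht, Measure.smul_apply, smul_eq_mul, Measure.restrict_apply ht]
  refine measure_le_smul_of_closedBall (μ := μ) (lam := lam) (div_pos hρ₀ hL0) (fun x hx ρ hρ hρle => ?_)
  have hx' : x ∈ ball (0 : E) r := hx.2
  have hLρ : L * ρ ≤ ρ₀ := by rwa [le_div_iff₀ hL0, mul_comm] at hρle
  calc lam (closedBall x ρ) ≤
        ENNReal.ofReal (L ^ (2 * Module.finrank ℝ E)) * lam univ * (μ (ball 0 r))⁻¹ * μ (closedBall x ρ) :=
        measure_closedBall_le_smul hr hL h₁ h₂ hx' hρ hLρ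
    _ ≤ (C : ℝ≥0∞) * μ (closedBall x ρ) := by gcongr

end Summit.Ventures.LatticeQCDFlow.Exactness
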